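import Mathlib

/-!
# Every additive character of a finite ring is a shift of a primitive one
  ((A1′), the Pontryagin half at the residue level)

Lemma N5.L4(iii) of `route/TIER5.md` §N5.11.4 (the computation of `ε(ξ, ψ₀)` at conductor
`a = 2`) uses: «the map `y ↦ ξ^{-1}(1 + π_F y)` is a non-trivial additive character of `k_E`,
hence equals `y ↦ ψ̄(γ y)` for a unique `γ ∈ k_E^×`». Item (A1′) of §N5.12.6 («the characters
of `E_v` trivial on `F_v` are `x ↦ ψ₀(tx)`») has the same shape one level up; its
linear-algebra half is `T5CharactersTrivialOnBase`, its local-field Pontryagin half stays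
prose. At the RESIDUE level the Pontryagin half is finite-group duality, checked here:

* `exists_unique_mulShift_eq`: for a finite commutative ring `R` and a primitive additive
  character `ψ : AddChar R ℂ` (Mathlib's `AddChar.IsPrimitive`), every `χ : AddChar R ℂ` is
  `ψ.mulShift t : x ↦ ψ(t x)` for a UNIQUE `t` — `t ↦ ψ.mulShift t` is injective (Mathlib's
  `to_mulShift_inj_of_isPrimitive`) between finite sets of equal cardinality (`AddChar.card_eq`);
* `exists_unique_mulShift_eq_of_ne_one`: the shift `t` of a non-trivial `χ` is non-zero
  («`γ ∈ k_E^×`»).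

Declaration per README §8(d): «uses an L-value-free non-vanishing device: NO».
-/

namespace Summit.Ventures.HodgeRepro2.T5FiniteAddCharacters

variable {R : Type*} [CommRing R] [Fintype R]

/-- `t ↦ ψ(t·)` is a bijection `R → AddChar R ℂ` for a primitive `ψ`. -/
theorem mulShift_bijective {ψ : AddChar R ℂ} (hψ : ψ.IsPrimitive) :
    Function.Bijective ψ.mulShift := by
  classical
  rw [Fintype.bijective_iff_injective_and_card]
  exact ⟨AddChar.to_mulShift_inj_of_isPrimitive hψ, (AddChar.card_eq (α := R)).symm⟩

/-- THE RESIDUE-LEVEL (A1′): every additive character of a finite commutative ring is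
`x ↦ ψ(t x)` for a unique `t`, `ψ` a primitive character. -/
theorem exists_unique_mulShift_eq {ψ : AddChar R ℂ} (hψ : ψ.IsPrimitive) (χ : AddChar R ℂ) :
    ∃! t : R, ψ.mulShift t = χ :=
  (mulShift_bijective hψ).existsUnique χ

/-- The shift of a NON-trivial character is non-zero: «`y ↦ ψ̄(γ y)` for a unique `γ ∈ k_E^×`». -/
theorem exists_unique_mulShift_eq_of_ne_one {ψ : AddChar R ℂ} (hψ : ψ.IsPrimitive)
    (χ : AddChar R ℂ) (hχ : χ ≠ 1) : ∃! t : R, t ≠ 0 ∧ ψ.mulShift t = χ := by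
  obtain ⟨t, ht, huniq⟩ := exists_unique_mulShift_eq hψ χ
  refine ⟨t, ⟨?_, ht⟩, fun t' ht' => huniq t' ht'.2⟩
  rintro rfl
  apply hχ
  rw [← ht]
  ext x
  simp

end Summit.Ventures.HodgeRepro2.T5FiniteAddCharacters
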